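/-
Copyright (c) 2026. All rights reserved.
Released under Apache 2.0 license as described in the file LICENSE.
-/
import Literature.NumberTheory.ComplexMultiplication.DegenerateCMTypesElementaryAbelianMajorityType
import HarnessLib

/-!
# CM types of Kubota rank `5` on elementary abelian `2`-groups are exactly the translates of majority types

SETTING (tree `CMTypeRankCharacters`, T. Kubota [Kubota1965] §4 Lemma 2 = B. B. Gordon [Gordon1999HodgeAVSurvey]
Prop. 9.4.1).  `G` a finite commutative group of exponent `2` — the Galois group of a multiquadratic CM field `K` —
`ρ ∈ G` (`ρ ≠ 1`, complex conjugation), `T ⊆ G` a CM type (`IsCMTypeWith ρ T`: `T ⊔ ρT = G`), characters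
`χ : AddChar (Additive G) ℂ` (`±1`-valued), `Ŝ(χ) = Σ_{t ∈ T} χ(t)`, `rank(T) = 1 + #{χ odd : Ŝ(χ) ≠ 0}`
(Kubota); the odd `χ` with `Ŝ(χ) ≠ 0` are the SURVIVORS.  For three distinct odd characters `χ₁, χ₂, χ₃` the
MAJORITY TYPE `Maj(χ₁, χ₂, χ₃) = {g : at least two of χᵢ(g) = +1}` has rank `5` in every order (tree
`ExponentTwo.typeRank_eq_five_of_majority`, its survivors being `χ₁, χ₂, χ₃, χ₁χ₂χ₃` with
`Ŝ = |G|/4, |G|/4, |G|/4, −|G|/4`), and the tree knows conversely (`ExponentTwo.exists_survivors_eq_of_typeRank_eq_five`,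
by Titsworth's relation) that the four survivors of ANY rank-`5` type are of the form `χ₁, χ₂, χ₃, χ₁χ₂χ₃`.
THIS FILE closes the circle:

> **Theorem** (`typeRank_eq_five_iff_exists_majority_translate`).  On a finite commutative group of exponent `2`,
> a CM type `T` has Kubota rank `5` **iff `T` is a translate of a majority type**: there are distinct odd
> characters `χ₁, χ₂, χ₃` and `u ∈ G` with `ug ∈ T ⟺ Maj(χ₁, χ₂, χ₃)(g)` for all `g`.

Equivalently (Boolean-function language, `G = 𝔽₂ⁿ`): the indicator of a CM type whose Walsh transform has exactly
four non-zero frequencies is affinely equivalent to the majority function of three coordinates — a PARTIALLY-BENT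
function with a `2`-variable bent kernel (C. Carlet [Carlet2020] §6.2, Prop. 94 and Def. 62: the Walsh support of
such a function is a flat and its non-zero Walsh values have one absolute value); in Kubota's language
([Kubota1965] §2: every CM type is induced from a primitive one, of the same rank): the rank-`5` types are exactly
the types INDUCED FROM THE NONDEGENERATE TYPES OF AN ORDER-`8` QUOTIENT `G/N`, `N = ker χ₁ ∩ ker χ₂ ∩ ker χ₃`
(on `(ℤ/2)³` the types of rank `5 = 8/2 + 1` are the eight translates of majority types).  The proof is Fourier
inversion (B. Dodson's weight method [Dodson1984] §3.1.1, tree `AbelianStabilizer.card_mul_indicator_eq_card_add_sum_odd`):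
`|G|·𝟙_T = |T| + Σ_{i ≤ 4} Ŝ(χᵢ)χᵢ` with `χ₄ = χ₁χ₂χ₃`; evaluating on the sign classes of `(χ₁, χ₂, χ₃)` forces
`|Ŝ(χᵢ)| = |G|/4` with an odd number of minus signs, and the translate by a `u` carrying the signs of
`Ŝ(χ₁), Ŝ(χ₂), Ŝ(χ₃)` is the majority type.

* §1 (every finite commutative `G`) `AbelianTranslate.isCMTypeWith_image_mul`, **`AbelianTranslate.typeRank_image_mul_eq`**
  — a translate `Tu` of a CM type is a CM type OF THE SAME RANK (same survivors: `Ŝ_{Tu}(χ) = χ(u)Ŝ_T(χ)`).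
* §2 `card_mul_indicator_eq_of_survivors_eq` (inversion with four survivors),
  **`exists_forall_mul_mem_iff_majority_of_survivors_eq`** (survivors `χ₁, χ₂, χ₃, χ₁χ₂χ₃` ⟹ `T` is a translate of
  `Maj(χ₁, χ₂, χ₃)`), **`exists_majority_translate_of_typeRank_eq_five`**, `typeRank_eq_five_of_majority_translate`,
  **`typeRank_eq_five_iff_exists_majority_translate`**.
* §3 consequences for a rank-`5` type: `forall_mul_mem_iff_iff_of_majority_translate` and
  **`eight_mul_card_stabilizer_of_typeRank_eq_five`** (`|Stab(T)| = |G|/8` EXACTLY — the tree's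
  `card_le_eight_mul_card_filter_forall_mul_mem_iff_of_typeRank_eq_five` was `≥`; on the field side: a rank-`5` type
  of a multiquadratic CM field of degree `2^{n+1}` is induced from an octic subfield and from no other),
  `four_mul_sum_char_eq_or_of_typeRank_eq_five` (every survivor has `Ŝ(χ) = ±|G|/4`) and
  `eight_mul_card_filter_eq_neg_one_or_of_typeRank_eq_five` (its sign count `a_χ = #{t ∈ T : χ(t) = −1}` is `|G|/8`
  or `3|G|/8`).

HONEST SCOPE.  Elementary character sums (orthogonality, inversion) on Kubota's formula; the sources print the
formula (Kubota, Gordon), the inversion/weight method (Dodson), the induced-type dictionary (Kubota §2, Shimura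
§8.4) and the structure of Boolean functions with flat Walsh support (Carlet); the displayed classification is this
file's regrouping of them for CM types, not a numbered statement of the sources.  THEOREMS ONLY: no definition, no
named fact, no instance, no `sorry`.

## References

* [Kubota1965] T. Kubota, *On the field extension by complex multiplication*, Trans. AMS 118 (1965), §2 (induced
  and primitive types, p. 115), §4 Lemma 2 (p. 119).
* [Gordon1999HodgeAVSurvey] B. B. Gordon, *A survey of the Hodge conjecture for abelian varieties*, Prop. 9.4.1.
* [Dodson1984] B. Dodson, *The structure of Galois groups of CM-fields*, Trans. AMS 283 (1984), §3.1.1 Theorem (proof).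
* [Carlet2020] C. Carlet, *Boolean Functions for Cryptography and Coding Theory*, CUP 2020, §2.3 (2.47), (2.51)
  (p. 61), §6.2 Prop. 94 and Def. 62 (pp. 255–257), Ch. 9 (majority function, p. 335).
* [Shimura1998] G. Shimura, *Abelian Varieties with Complex Multiplication and Modular Functions*, §8.4 Example (1).

## Provenance

Lane `lit-hodgefound` (Track 2, Layer A3), seat `lit-hodgefound-p10` generation 39, row g39-#5; neighbours cited by
name, nothing restated: `DegenerateCMTypesElementaryAbelianMajorityType` (`isCMTypeWith_of_majority`,
`typeRank_eq_five_of_majority`, `survivors_eq_of_majority`, `four_mul_sum_char_of_majority₁₂₃`,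
`four_mul_sum_char_add_of_majority`, `forall_mul_mem_iff_iff_of_majority`, `eight_mul_card_filter_eq_eq_eq_of_odd`),
`DegenerateCMTypesElementaryAbelianStabilizerRank` (`exists_survivors_eq_of_typeRank_eq_five`),
`DegenerateCMTypesAbelianStabilizerCharacters` (`AbelianStabilizer.card_mul_indicator_eq_card_add_sum_odd`,
`sum_char_image_mul_eq`), `DegenerateCMTypesElementaryAbelianTwoGroup` (`sum_char_eq_card_sub_two_mul`),
`CMTypeRankCharacters` (`IsCMTypeWith.typeRank_eq_one_add_ncard_oddCharacters`), `CMTypeElementaryTwoGroupOddWeights`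
(`character_apply_eq_one_or_of_mul_self`); the quotient form of §1 is the tree's
`AlgebraicGeometry/ComplexMultiplication/DemjanenkoMatrixRank.typeRank_image_mk_eq`.
-/

open scoped BigOperators Classical

namespace Literature.NumberTheory.ComplexMultiplication

namespace CyclicCMType

variable {G : Type*} [CommGroup G] [Fintype G] [DecidableEq G] {ρ : G} {T : Finset G}
  {χ₁ χ₂ χ₃ : AddChar (Additive G) ℂ}

/-! ## §0 Helpers -/

section Helpers

omit [Fintype G] [DecidableEq G] in
/-- `g·g = 1` in exponent `2`. [folklore] -/
private theorem mul_self_eq_one_rf (hexp : ∀ g : G, g ^ 2 = 1) (g : G) : g * g = 1 := by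
  rw [← pow_two]; exact hexp g

omit [Fintype G] [DecidableEq G] in
/-- `g⁻¹ = g` in exponent `2`. [folklore] -/
private theorem inv_eq_self_rf (hexp : ∀ g : G, g ^ 2 = 1) (g : G) : g⁻¹ = g :=
  inv_eq_of_mul_eq_one_right (mul_self_eq_one_rf hexp g)

omit [Fintype G] [DecidableEq G] in
/-- Characters of a group of exponent `2` are `±1`-valued. [cite: Kubota1965, §4 Lemma 2 (proof)] -/
private theorem char_eq_one_or_rf (hexp : ∀ g : G, g ^ 2 = 1) (χ : AddChar (Additive G) ℂ) (g : G) :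
    χ (Additive.ofMul g) = 1 ∨ χ (Additive.ofMul g) = -1 :=
  character_apply_eq_one_or_of_mul_self χ (mul_self_eq_one_rf hexp g)

omit [Fintype G] [DecidableEq G] in
/-- `χ(gh) = χ(g)χ(h)`. [folklore] -/
private theorem char_mul_rf (χ : AddChar (Additive G) ℂ) (g h : G) :
    χ (Additive.ofMul (g * h)) = χ (Additive.ofMul g) * χ (Additive.ofMul h) := by
  rw [ofMul_mul, AddChar.map_add_eq_mul]

omit [Fintype G] [DecidableEq G] in
/-- `χ(g) ≠ 0`. [folklore] -/
private theorem char_ne_zero_rf (χ : AddChar (Additive G) ℂ) (g : G) : χ (Additive.ofMul g) ≠ 0 := by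
  intro h0
  have h1 : χ (Additive.ofMul g) * χ (Additive.ofMul g⁻¹) = 1 := by
    rw [← char_mul_rf, mul_inv_cancel, ofMul_one, AddChar.map_zero_eq_one]
  rw [h0, zero_mul] at h1
  exact zero_ne_one h1

/-- `2|T| = |G|`. [folklore] -/
private theorem two_mul_card_rf (h : IsCMTypeWith ρ (T : Set G)) : 2 * T.card = Fintype.card G := by
  have hρ2 : ρ * ρ = 1 := by
    have := h.invol (1 : G)
    simpa [smul_eq_mul] using this
  have hmem : ∀ x : G, ρ * x ∈ T ↔ x ∉ T := fun x => by
    have := h.rho_smul_mem_iff x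
    simpa only [smul_eq_mul, Finset.mem_coe] using this
  have hinj : Function.Injective fun s : G => ρ * s := fun a b hab => mul_left_cancel hab
  have hc : Tᶜ = T.image fun s => ρ * s := by
    ext x
    rw [Finset.mem_compl, Finset.mem_image]
    constructor
    · intro hx
      refine ⟨ρ * x, (hmem x).2 hx, ?_⟩
      show ρ * (ρ * x) = x
      rw [← mul_assoc, hρ2, one_mul]
    · rintro ⟨s, hs, rfl⟩
      exact fun hx => ((hmem s).1 hx) hs
  have h1 : Tᶜ.card = T.card := by rw [hc, Finset.card_image_of_injective _ hinj]
  have h2 := Finset.card_add_card_compl T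
  omega

omit [Fintype G] in
/-- Membership in a translate: `x ∈ Su ⟺ xu⁻¹ ∈ S`. [folklore] -/
private theorem mem_image_mul_iff_rf (S : Finset G) (u x : G) :
    x ∈ S.image (fun s => s * u) ↔ x * u⁻¹ ∈ S := by
  rw [Finset.mem_image]
  constructor
  · rintro ⟨s, hs, rfl⟩
    rwa [mul_inv_cancel_right]
  · intro hx
    exact ⟨x * u⁻¹, hx, inv_mul_cancel_right x u⟩

omit [Fintype G] in
/-- If `ug ∈ T ⟺ P(g)` and `M = {g : P(g)}` then `T = Mu`. [folklore] -/
private theorem eq_image_mul_of_forall_iff_rf {P : G → Prop} {M : Finset G} {u : G}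
    (hM : ∀ g : G, g ∈ M ↔ P g) (hT : ∀ g : G, u * g ∈ T ↔ P g) : T = M.image fun s => s * u := by
  ext x
  rw [mem_image_mul_iff_rf, hM, ← hT (x * u⁻¹), mul_comm x u⁻¹, mul_inv_cancel_left]

omit [Fintype G] [DecidableEq G] in
/-- If `ug ∈ T ⟺ P(g)` and `M = {g : P(g)}` then `T` and `M` have the same stabiliser. [folklore] -/
private theorem forall_mul_mem_iff_translate_rf {P : G → Prop} {M : Finset G} {u : G}
    (hM : ∀ g : G, g ∈ M ↔ P g) (hT : ∀ g : G, u * g ∈ T ↔ P g) (x : G) :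
    (∀ y : G, y * x ∈ T ↔ y ∈ T) ↔ ∀ y : G, y * x ∈ M ↔ y ∈ M := by
  have hmemT : ∀ y : G, y ∈ T ↔ u⁻¹ * y ∈ M := fun y => by
    rw [hM, ← hT (u⁻¹ * y), mul_inv_cancel_left]
  constructor
  · intro hx y
    have h1 := hx (u * y)
    rw [hmemT, hmemT, mul_assoc, inv_mul_cancel_left, inv_mul_cancel_left] at h1
    exact h1
  · intro hx y
    rw [hmemT, hmemT, ← mul_assoc]
    exact hx (u⁻¹ * y)

omit [Fintype G] [DecidableEq G] in
/-- An odd character is non-trivial. [folklore] -/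
private theorem ne_zero_of_odd_rf {χ : AddChar (Additive G) ℂ} (hχ : χ (Additive.ofMul ρ) = -1) : χ ≠ 0 := by
  intro h0
  rw [h0, AddChar.zero_apply] at hχ
  norm_num at hχ

omit [Fintype G] [DecidableEq G] in
/-- In exponent `2`, distinct characters have non-trivial product (`χ² = 1`). [cite: Kubota1965, §4 Lemma 2 (proof)] -/
private theorem add_ne_zero_of_ne_rf (hexp : ∀ g : G, g ^ 2 = 1) {χ χ' : AddChar (Additive G) ℂ} (hne : χ ≠ χ') :
    χ + χ' ≠ 0 := by
  intro h0
  exact hne (add_left_cancel ((ExponentTwo.add_self_eq_zero_char hexp χ).trans h0.symm))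

omit [Fintype G] [DecidableEq G] in
/-- `χ₁ ≠ χ₁χ₂χ₃` for `χ₂ ≠ χ₃` (exponent `2`). [folklore] -/
private theorem ne_add_add₁_rf (hexp : ∀ g : G, g ^ 2 = 1) (h23 : χ₂ ≠ χ₃) : χ₁ ≠ χ₁ + χ₂ + χ₃ := by
  intro h
  apply add_ne_zero_of_ne_rf hexp h23
  have : χ₁ + 0 = χ₁ + (χ₂ + χ₃) := by rw [add_zero, ← add_assoc]; exact h
  exact (add_left_cancel this).symm

omit [Fintype G] [DecidableEq G] in
/-- `χ₂ ≠ χ₁χ₂χ₃` for `χ₁ ≠ χ₃` (exponent `2`). [folklore] -/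
private theorem ne_add_add₂_rf (hexp : ∀ g : G, g ^ 2 = 1) (h13 : χ₁ ≠ χ₃) : χ₂ ≠ χ₁ + χ₂ + χ₃ := by
  intro h
  apply add_ne_zero_of_ne_rf hexp h13
  have : χ₂ + 0 = χ₂ + (χ₁ + χ₃) := by
    rw [add_zero]
    calc χ₂ = χ₁ + χ₂ + χ₃ := h
      _ = χ₂ + (χ₁ + χ₃) := by abel
  exact (add_left_cancel this).symm

omit [Fintype G] [DecidableEq G] in
/-- `χ₃ ≠ χ₁χ₂χ₃` for `χ₁ ≠ χ₂` (exponent `2`). [folklore] -/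
private theorem ne_add_add₃_rf (hexp : ∀ g : G, g ^ 2 = 1) (h12 : χ₁ ≠ χ₂) : χ₃ ≠ χ₁ + χ₂ + χ₃ := by
  intro h
  apply add_ne_zero_of_ne_rf hexp h12
  have : χ₃ + 0 = χ₃ + (χ₁ + χ₂) := by
    rw [add_zero]
    calc χ₃ = χ₁ + χ₂ + χ₃ := h
      _ = χ₃ + (χ₁ + χ₂) := by abel
  exact (add_left_cancel this).symm

omit [DecidableEq G] in
/-- Every sign class `(s₁, s₂, s₃) ∈ {±1}³` of three distinct odd characters is inhabited (it has `|G|/8` elements,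
tree `eight_mul_card_filter_eq_eq_eq_of_odd`). [cite: Kubota1965, §4 Lemma 2 (proof)] -/
private theorem exists_apply_eq_rf (hexp : ∀ g : G, g ^ 2 = 1) (hχ₁ : χ₁ (Additive.ofMul ρ) = -1)
    (hχ₂ : χ₂ (Additive.ofMul ρ) = -1) (hχ₃ : χ₃ (Additive.ofMul ρ) = -1) (h12 : χ₁ ≠ χ₂) (h13 : χ₁ ≠ χ₃)
    (h23 : χ₂ ≠ χ₃) {s₁ s₂ s₃ : ℂ} (hs₁ : s₁ = 1 ∨ s₁ = -1) (hs₂ : s₂ = 1 ∨ s₂ = -1) (hs₃ : s₃ = 1 ∨ s₃ = -1) :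
    ∃ t : G, χ₁ (Additive.ofMul t) = s₁ ∧ χ₂ (Additive.ofMul t) = s₂ ∧ χ₃ (Additive.ofMul t) = s₃ := by
  have h8 := ExponentTwo.eight_mul_card_filter_eq_eq_eq_of_odd hexp hχ₁ hχ₂ hχ₃ h12 h13 h23 hs₁ hs₂ hs₃
  have hpos : 0 < (Finset.univ.filter fun g : G => χ₁ (Additive.ofMul g) = s₁ ∧ χ₂ (Additive.ofMul g) = s₂ ∧
      χ₃ (Additive.ofMul g) = s₃).card := by
    have : 0 < Fintype.card G := Fintype.card_pos
    omega
  obtain ⟨t, ht⟩ := Finset.card_pos.1 hpos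
  simp only [Finset.mem_filter, Finset.mem_univ, true_and] at ht
  exact ⟨t, ht⟩

/-- The arithmetic of the four sign classes: `m + (±w₁ ± w₂ ± w₃ ± w₄) ∈ {0, 2m}` on the classes
`(+,+,+), (+,+,−), (+,−,+), (−,+,+)` with `w₃, w₄ ≠ 0` forces `2wᵢ = sᵢm`, `sᵢ = ±1`, `s₁s₂s₃s₄ = −1`. [folklore] -/
private theorem signs_rf {m w₁ w₂ w₃ w₄ v₀ v₁ v₂ v₃ : ℤ} (hw₃ : w₃ ≠ 0) (hw₄ : w₄ ≠ 0)
    (hv₀ : v₀ = 0 ∨ v₀ = 2 * m) (hv₁ : v₁ = 0 ∨ v₁ = 2 * m) (hv₂ : v₂ = 0 ∨ v₂ = 2 * m)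
    (hv₃ : v₃ = 0 ∨ v₃ = 2 * m) (E0 : v₀ = m + (w₁ + w₂ + w₃ + w₄)) (E1 : v₁ = m + (w₁ + w₂ - w₃ - w₄))
    (E2 : v₂ = m + (w₁ - w₂ + w₃ - w₄)) (E3 : v₃ = m + (-w₁ + w₂ + w₃ - w₄)) :
    ∃ s₁ s₂ s₃ s₄ : ℤ, (s₁ = 1 ∨ s₁ = -1) ∧ (s₂ = 1 ∨ s₂ = -1) ∧ (s₃ = 1 ∨ s₃ = -1) ∧
      s₁ * s₂ * s₃ * s₄ = -1 ∧ 2 * w₁ = s₁ * m ∧ 2 * w₂ = s₂ * m ∧ 2 * w₃ = s₃ * m ∧ 2 * w₄ = s₄ * m := by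
  have hAB : ((w₁ + w₂ = m ∨ w₁ + w₂ = -m) ∧ w₃ + w₄ = 0) ∨
      (w₁ + w₂ = 0 ∧ (w₃ + w₄ = m ∨ w₃ + w₄ = -m)) := by
    rcases hv₀ with rfl | rfl <;> rcases hv₁ with rfl | rfl <;> omega
  have hCD : (w₁ - w₂ = 0 ∧ (w₃ - w₄ = m ∨ w₃ - w₄ = -m)) ∨
      ((w₁ - w₂ = m ∨ w₁ - w₂ = -m) ∧ w₃ - w₄ = 0) := by
    rcases hv₂ with rfl | rfl <;> rcases hv₃ with rfl | rfl <;> omega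
  rcases hAB with ⟨hA, hB⟩ | ⟨hA, hB⟩ <;> rcases hCD with ⟨hC, hD⟩ | ⟨hC, hD⟩
  · rcases hA with hA | hA <;> rcases hD with hD | hD
    · exact ⟨1, 1, 1, -1, Or.inl rfl, Or.inl rfl, Or.inl rfl, by norm_num, by omega, by omega, by omega, by omega⟩
    · exact ⟨1, 1, -1, 1, Or.inl rfl, Or.inl rfl, Or.inr rfl, by norm_num, by omega, by omega, by omega, by omega⟩
    · exact ⟨-1, -1, 1, -1, Or.inr rfl, Or.inr rfl, Or.inl rfl, by norm_num, by omega, by omega, by omega,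
        by omega⟩
    · exact ⟨-1, -1, -1, 1, Or.inr rfl, Or.inr rfl, Or.inr rfl, by norm_num, by omega, by omega, by omega,
        by omega⟩
  · exfalso; omega
  · exfalso; omega
  · rcases hB with hB | hB <;> rcases hC with hC | hC
    · exact ⟨1, -1, 1, 1, Or.inl rfl, Or.inr rfl, Or.inl rfl, by norm_num, by omega, by omega, by omega, by omega⟩
    · exact ⟨-1, 1, 1, 1, Or.inr rfl, Or.inl rfl, Or.inl rfl, by norm_num, by omega, by omega, by omega, by omega⟩
    · exact ⟨1, -1, -1, -1, Or.inl rfl, Or.inr rfl, Or.inr rfl, by norm_num, by omega, by omega, by omega,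
        by omega⟩
    · exact ⟨-1, 1, -1, -1, Or.inr rfl, Or.inl rfl, Or.inr rfl, by norm_num, by omega, by omega, by omega,
        by omega⟩

/-- The last step: `2·|G|𝟙[P] = 2m + m(a + b + c − abc)` for signs `a, b, c` holds iff `P ⟺ Maj(a, b, c)`. [folklore] -/
private theorem iff_majority_of_key_rf {m a b c : ℂ} (hm0 : m ≠ 0) (ha : a = 1 ∨ a = -1) (hb : b = 1 ∨ b = -1)
    (hc : c = 1 ∨ c = -1) {P : Prop} {_hP : Decidable P}
    (key : 2 * (if P then 2 * m else 0) = 2 * m + m * a + m * b + m * c - m * (a * b * c)) :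
    P ↔ (a = 1 ∧ b = 1) ∨ (a = 1 ∧ c = 1) ∨ (b = 1 ∧ c = 1) := by
  have crit : P ↔ m * (a + b + c - a * b * c - 2) = 0 := by
    by_cases hP : P
    · simp only [hP, true_iff]
      rw [if_pos hP] at key
      linear_combination (-1 : ℂ) * key
    · simp only [hP, false_iff]
      rw [if_neg hP] at key
      intro h0
      apply hm0
      linear_combination (-1 / 4 : ℂ) * h0 + (-1 / 4 : ℂ) * key
  rw [crit]
  rcases ha with rfl | rfl <;> rcases hb with rfl | rfl <;> rcases hc with rfl | rfl <;> norm_num [hm0]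

end Helpers

/-! ## §1 Translates of a CM type on a finite commutative group: same survivors, same rank -/

namespace AbelianTranslate

omit [Fintype G] in
/-- **A translate `Tu` of a CM type is a CM type** (w.r.t. the same `ρ`): `x ∈ Tu ⟺ xu⁻¹ ∈ T`, and `ρ` commutes
with the translation. [cite: Shimura1998, §8.4 Example (1)] [cite: Kubota1965, §2] -/
theorem isCMTypeWith_image_mul (h : IsCMTypeWith ρ (T : Set G)) (u : G) :
    IsCMTypeWith ρ ((T.image fun s => s * u : Finset G) : Set G) := by
  refine ⟨fun x => ?_, h.comm, h.invol⟩
  have h1 := h.mem_iff (x * u⁻¹)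
  simp only [Finset.mem_coe, smul_eq_mul] at h1 ⊢
  rw [mem_image_mul_iff_rf, mem_image_mul_iff_rf, mul_assoc]
  exact h1

/-- **A translate has the same Kubota rank**: `Ŝ_{Tu}(χ) = χ(u)·Ŝ_T(χ)` (tree `AbelianStabilizer.sum_char_image_mul_eq`)
with `χ(u) ≠ 0`, so `Tu` and `T` have the same surviving odd characters, and `rank = 1 + #survivors` (Kubota).  On
the field side: the rank of `(K, Φ)` depends only on the `Gal(K/ℚ)`-orbit of `Φ` (`K` abelian).
[cite: Kubota1965, §4 Lemma 2] [cite: Shimura1998, §8.4 Example (1)] -/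
theorem typeRank_image_mul_eq (h : IsCMTypeWith ρ (T : Set G)) (u : G) :
    typeRank G ((T.image fun s => s * u : Finset G) : Set G) = typeRank G (T : Set G) := by
  rw [(isCMTypeWith_image_mul h u).typeRank_eq_one_add_ncard_oddCharacters,
    h.typeRank_eq_one_add_ncard_oddCharacters]
  have hset : {χ : AddChar (Additive G) ℂ | χ (Additive.ofMul ρ) = -1 ∧
      ∑ s ∈ T.image (fun s => s * u), χ (Additive.ofMul s) ≠ 0} =
      {χ : AddChar (Additive G) ℂ | χ (Additive.ofMul ρ) = -1 ∧ ∑ s ∈ T, χ (Additive.ofMul s) ≠ 0} := by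
    ext χ
    simp only [Set.mem_setOf_eq, AbelianStabilizer.sum_char_image_mul_eq χ T u, mul_ne_zero_iff]
    exact ⟨fun hh => ⟨hh.1, hh.2.2⟩, fun hh => ⟨hh.1, char_ne_zero_rf χ u, hh.2⟩⟩
  rw [hset]

end AbelianTranslate

namespace ExponentTwo

/-! ## §2 Rank `5` ⟺ translate of a majority type -/

section Structure

/-- **Inversion with four survivors**: if the surviving odd characters of the CM type `T` are exactly
`χ₁, χ₂, χ₃, χ₁χ₂χ₃` (distinct), then for every `x ∈ G`
`|G|·𝟙_T(x) = |T| + Ŝ(χ₁)χ₁(x) + Ŝ(χ₂)χ₂(x) + Ŝ(χ₃)χ₃(x) + Ŝ(χ₁χ₂χ₃)(χ₁χ₂χ₃)(x)` (the general inversion formula,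
tree `AbelianStabilizer.card_mul_indicator_eq_card_add_sum_odd`, the vanishing odd characters dropped; `x⁻¹ = x`).
[cite: Dodson1984, §3.1.1 Theorem (proof)] [cite: Kubota1965, §4 Lemma 2] -/
theorem card_mul_indicator_eq_of_survivors_eq (hexp : ∀ g : G, g ^ 2 = 1) (h : IsCMTypeWith ρ (T : Set G))
    (h12 : χ₁ ≠ χ₂) (h13 : χ₁ ≠ χ₃) (h23 : χ₂ ≠ χ₃)
    (hsurv : ((Finset.univ.filter fun χ : AddChar (Additive G) ℂ => χ (Additive.ofMul ρ) = -1).filter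
      fun χ => ∑ s ∈ T, χ (Additive.ofMul s) ≠ 0) = {χ₁, χ₂, χ₃, χ₁ + χ₂ + χ₃}) (x : G) :
    (if x ∈ T then (Fintype.card G : ℂ) else 0) = (T.card : ℂ) +
      ((∑ s ∈ T, χ₁ (Additive.ofMul s)) * χ₁ (Additive.ofMul x) +
        (∑ s ∈ T, χ₂ (Additive.ofMul s)) * χ₂ (Additive.ofMul x) +
        (∑ s ∈ T, χ₃ (Additive.ofMul s)) * χ₃ (Additive.ofMul x) +
        (∑ s ∈ T, (χ₁ + χ₂ + χ₃) (Additive.ofMul s)) * (χ₁ + χ₂ + χ₃) (Additive.ofMul x)) := by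
  rw [AbelianStabilizer.card_mul_indicator_eq_card_add_sum_odd h x, inv_eq_self_rf hexp x]
  congr 1
  have hzero : ∑ χ ∈ Finset.univ.filter (fun χ : AddChar (Additive G) ℂ => χ (Additive.ofMul ρ) = -1),
      (∑ s ∈ T, χ (Additive.ofMul s)) * χ (Additive.ofMul x) =
      ∑ χ ∈ (Finset.univ.filter fun χ : AddChar (Additive G) ℂ => χ (Additive.ofMul ρ) = -1).filter
        (fun χ => ∑ s ∈ T, χ (Additive.ofMul s) ≠ 0), (∑ s ∈ T, χ (Additive.ofMul s)) * χ (Additive.ofMul x) := by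
    symm
    apply Finset.sum_filter_of_ne
    intro χ _ hne h0
    exact hne (by rw [h0, zero_mul])
  have hn3 : χ₃ ∉ ({χ₁ + χ₂ + χ₃} : Finset (AddChar (Additive G) ℂ)) := by
    simp only [Finset.mem_singleton]; exact ne_add_add₃_rf hexp h12
  have hn2 : χ₂ ∉ ({χ₃, χ₁ + χ₂ + χ₃} : Finset (AddChar (Additive G) ℂ)) := by
    simp only [Finset.mem_insert, Finset.mem_singleton, not_or]; exact ⟨h23, ne_add_add₂_rf hexp h13⟩
  have hn1 : χ₁ ∉ ({χ₂, χ₃, χ₁ + χ₂ + χ₃} : Finset (AddChar (Additive G) ℂ)) := by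
    simp only [Finset.mem_insert, Finset.mem_singleton, not_or]; exact ⟨h12, h13, ne_add_add₁_rf hexp h23⟩
  rw [hzero, hsurv, Finset.sum_insert hn1, Finset.sum_insert hn2, Finset.sum_insert hn3, Finset.sum_singleton]
  ring

/-- **SURVIVORS `χ₁, χ₂, χ₃, χ₁χ₂χ₃` ⟹ `T` IS A TRANSLATE OF THE MAJORITY TYPE `Maj(χ₁, χ₂, χ₃)`**: there is
`u ∈ G` with `ug ∈ T ⟺ (at least two of χ₁(g), χ₂(g), χ₃(g) are +1)` for all `g`.  Proof: write
`|G|𝟙_T = |T| + Σᵢ Ŝᵢχᵢ` (`χ₄ = χ₁χ₂χ₃`) and evaluate on the sign classes `(+,+,+), (+,+,−), (+,−,+), (−,+,+)`: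
the four values `|T| + (±Ŝ₁ ± Ŝ₂ ± Ŝ₃ ± Ŝ₄) ∈ {0, |G|}` with `Ŝᵢ ≠ 0` force `2Ŝᵢ = ±|T|` (`= ±|G|/4·2`) with
an odd number of minus signs; `u` in the sign class `(sgn Ŝ₁, sgn Ŝ₂, sgn Ŝ₃)` does it.
[cite: Kubota1965, §4 Lemma 2] [cite: Dodson1984, §3.1.1 Theorem (proof)] [cite: Carlet2020, §6.2 Prop. 94, Def. 62] -/
theorem exists_forall_mul_mem_iff_majority_of_survivors_eq (hexp : ∀ g : G, g ^ 2 = 1)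
    (h : IsCMTypeWith ρ (T : Set G)) (hχ₁ : χ₁ (Additive.ofMul ρ) = -1) (hχ₂ : χ₂ (Additive.ofMul ρ) = -1)
    (hχ₃ : χ₃ (Additive.ofMul ρ) = -1) (h12 : χ₁ ≠ χ₂) (h13 : χ₁ ≠ χ₃) (h23 : χ₂ ≠ χ₃)
    (hsurv : ((Finset.univ.filter fun χ : AddChar (Additive G) ℂ => χ (Additive.ofMul ρ) = -1).filter
      fun χ => ∑ s ∈ T, χ (Additive.ofMul s) ≠ 0) = {χ₁, χ₂, χ₃, χ₁ + χ₂ + χ₃}) :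
    ∃ u : G, ∀ g : G, u * g ∈ T ↔ (χ₁ (Additive.ofMul g) = 1 ∧ χ₂ (Additive.ofMul g) = 1) ∨
      (χ₁ (Additive.ofMul g) = 1 ∧ χ₃ (Additive.ofMul g) = 1) ∨ (χ₂ (Additive.ofMul g) = 1 ∧ χ₃ (Additive.ofMul g) = 1) := by
  have hTc : 2 * T.card = Fintype.card G := two_mul_card_rf h
  have hG2 : (Fintype.card G : ℂ) = 2 * (T.card : ℂ) := by exact_mod_cast hTc.symm
  have hm0 : (T.card : ℂ) ≠ 0 := by
    have : 0 < Fintype.card G := Fintype.card_pos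
    have : T.card ≠ 0 := by omega
    exact_mod_cast this
  -- the survivors `χ₃, χ₁χ₂χ₃` do not vanish on `T` (all four do; these two are the ones used)
  have hmem : ∀ χ : AddChar (Additive G) ℂ,
      χ ∈ ({χ₁, χ₂, χ₃, χ₁ + χ₂ + χ₃} : Finset (AddChar (Additive G) ℂ)) → ∑ s ∈ T, χ (Additive.ofMul s) ≠ 0 :=
    fun χ hχ => by
    rw [← hsurv, Finset.mem_filter] at hχ
    exact hχ.2
  have hS₃ : ∑ s ∈ T, χ₃ (Additive.ofMul s) ≠ 0 := hmem χ₃ (by simp)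
  have hS₄ : ∑ s ∈ T, (χ₁ + χ₂ + χ₃) (Additive.ofMul s) ≠ 0 := hmem (χ₁ + χ₂ + χ₃) (by simp)
  -- the character sums are integers
  obtain ⟨w₁, hw₁⟩ : ∃ w : ℤ, ∑ s ∈ T, χ₁ (Additive.ofMul s) = (w : ℂ) :=
    ⟨(T.card : ℤ) - 2 * ((T.filter fun s => χ₁ (Additive.ofMul s) = -1).card : ℤ), by
      exact_mod_cast sum_char_eq_card_sub_two_mul hexp χ₁ T⟩
  obtain ⟨w₂, hw₂⟩ : ∃ w : ℤ, ∑ s ∈ T, χ₂ (Additive.ofMul s) = (w : ℂ) :=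
    ⟨(T.card : ℤ) - 2 * ((T.filter fun s => χ₂ (Additive.ofMul s) = -1).card : ℤ), by
      exact_mod_cast sum_char_eq_card_sub_two_mul hexp χ₂ T⟩
  obtain ⟨w₃, hw₃⟩ : ∃ w : ℤ, ∑ s ∈ T, χ₃ (Additive.ofMul s) = (w : ℂ) :=
    ⟨(T.card : ℤ) - 2 * ((T.filter fun s => χ₃ (Additive.ofMul s) = -1).card : ℤ), by
      exact_mod_cast sum_char_eq_card_sub_two_mul hexp χ₃ T⟩
  obtain ⟨w₄, hw₄⟩ : ∃ w : ℤ, ∑ s ∈ T, (χ₁ + χ₂ + χ₃) (Additive.ofMul s) = (w : ℂ) :=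
    ⟨(T.card : ℤ) - 2 * ((T.filter fun s => (χ₁ + χ₂ + χ₃) (Additive.ofMul s) = -1).card : ℤ), by
      exact_mod_cast sum_char_eq_card_sub_two_mul hexp (χ₁ + χ₂ + χ₃) T⟩
  have hw₃0 : w₃ ≠ 0 := fun h0 => hS₃ (by rw [hw₃, h0, Int.cast_zero])
  have hw₄0 : w₄ ≠ 0 := fun h0 => hS₄ (by rw [hw₄, h0, Int.cast_zero])
  -- the inversion formula
  have E : ∀ x : G, (if x ∈ T then (Fintype.card G : ℂ) else 0) = (T.card : ℂ) +
      ((w₁ : ℂ) * χ₁ (Additive.ofMul x) + (w₂ : ℂ) * χ₂ (Additive.ofMul x) + (w₃ : ℂ) * χ₃ (Additive.ofMul x) +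
        (w₄ : ℂ) * (χ₁ + χ₂ + χ₃) (Additive.ofMul x)) := fun x => by
    rw [card_mul_indicator_eq_of_survivors_eq hexp h h12 h13 h23 hsurv x, hw₁, hw₂, hw₃, hw₄]
  -- … evaluated on a sign class `(a, b, c)`
  have hval : ∀ {x : G} {a b c : ℂ}, χ₁ (Additive.ofMul x) = a → χ₂ (Additive.ofMul x) = b →
      χ₃ (Additive.ofMul x) = c → ∃ v : ℤ, (v = 0 ∨ v = 2 * (T.card : ℤ)) ∧
        (v : ℂ) = (T.card : ℂ) + ((w₁ : ℂ) * a + (w₂ : ℂ) * b + (w₃ : ℂ) * c + (w₄ : ℂ) * (a * b * c)) := by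
    intro x a b c ha hb hc
    have Ex := E x
    rw [AddChar.add_apply, AddChar.add_apply, ha, hb, hc] at Ex
    by_cases hx : x ∈ T
    · refine ⟨2 * (T.card : ℤ), Or.inr rfl, ?_⟩
      rw [if_pos hx, hG2] at Ex
      push_cast
      linear_combination Ex
    · refine ⟨0, Or.inl rfl, ?_⟩
      rw [if_neg hx] at Ex
      push_cast
      linear_combination Ex
  obtain ⟨x₀, ha₀, hb₀, hc₀⟩ := exists_apply_eq_rf hexp hχ₁ hχ₂ hχ₃ h12 h13 h23 (s₁ := 1) (s₂ := 1) (s₃ := 1)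
    (Or.inl rfl) (Or.inl rfl) (Or.inl rfl)
  obtain ⟨x₁, ha₁, hb₁, hc₁⟩ := exists_apply_eq_rf hexp hχ₁ hχ₂ hχ₃ h12 h13 h23 (s₁ := 1) (s₂ := 1) (s₃ := -1)
    (Or.inl rfl) (Or.inl rfl) (Or.inr rfl)
  obtain ⟨x₂, ha₂, hb₂, hc₂⟩ := exists_apply_eq_rf hexp hχ₁ hχ₂ hχ₃ h12 h13 h23 (s₁ := 1) (s₂ := -1) (s₃ := 1)
    (Or.inl rfl) (Or.inr rfl) (Or.inl rfl)
  obtain ⟨x₃, ha₃, hb₃, hc₃⟩ := exists_apply_eq_rf hexp hχ₁ hχ₂ hχ₃ h12 h13 h23 (s₁ := -1) (s₂ := 1) (s₃ := 1)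
    (Or.inr rfl) (Or.inl rfl) (Or.inl rfl)
  obtain ⟨v₀, hv₀, E0⟩ := hval ha₀ hb₀ hc₀
  obtain ⟨v₁, hv₁, E1⟩ := hval ha₁ hb₁ hc₁
  obtain ⟨v₂, hv₂, E2⟩ := hval ha₂ hb₂ hc₂
  obtain ⟨v₃, hv₃, E3⟩ := hval ha₃ hb₃ hc₃
  have E0' : v₀ = (T.card : ℤ) + (w₁ + w₂ + w₃ + w₄) := by
    have : (v₀ : ℂ) = (T.card : ℂ) + ((w₁ : ℂ) + w₂ + w₃ + w₄) := by linear_combination E0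
    exact_mod_cast this
  have E1' : v₁ = (T.card : ℤ) + (w₁ + w₂ - w₃ - w₄) := by
    have : (v₁ : ℂ) = (T.card : ℂ) + ((w₁ : ℂ) + w₂ - w₃ - w₄) := by linear_combination E1
    exact_mod_cast this
  have E2' : v₂ = (T.card : ℤ) + (w₁ - w₂ + w₃ - w₄) := by
    have : (v₂ : ℂ) = (T.card : ℂ) + ((w₁ : ℂ) - w₂ + w₃ - w₄) := by linear_combination E2
    exact_mod_cast this
  have E3' : v₃ = (T.card : ℤ) + (-w₁ + w₂ + w₃ - w₄) := by
    have : (v₃ : ℂ) = (T.card : ℂ) + (-(w₁ : ℂ) + w₂ + w₃ - w₄) := by linear_combination E3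
    exact_mod_cast this
  -- the sixteen cases (eight contradictory): `2wᵢ = sᵢ|T|`, `sᵢ = ±1`, `s₁s₂s₃s₄ = −1`
  obtain ⟨s₁, s₂, s₃, s₄, hs₁, hs₂, hs₃, hP, k1, k2, k3, k4⟩ :=
    signs_rf hw₃0 hw₄0 hv₀ hv₁ hv₂ hv₃ E0' E1' E2' E3'
  -- the translating element: `χᵢ(u) = sᵢ`
  have hs₁' : ((s₁ : ℤ) : ℂ) = 1 ∨ ((s₁ : ℤ) : ℂ) = -1 := by rcases hs₁ with rfl | rfl <;> norm_num
  have hs₂' : ((s₂ : ℤ) : ℂ) = 1 ∨ ((s₂ : ℤ) : ℂ) = -1 := by rcases hs₂ with rfl | rfl <;> norm_num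
  have hs₃' : ((s₃ : ℤ) : ℂ) = 1 ∨ ((s₃ : ℤ) : ℂ) = -1 := by rcases hs₃ with rfl | rfl <;> norm_num
  have HS1 : ((s₁ : ℤ) : ℂ) * s₁ = 1 := by rcases hs₁ with rfl | rfl <;> norm_num
  have HS2 : ((s₂ : ℤ) : ℂ) * s₂ = 1 := by rcases hs₂ with rfl | rfl <;> norm_num
  have HS3 : ((s₃ : ℤ) : ℂ) * s₃ = 1 := by rcases hs₃ with rfl | rfl <;> norm_num
  have HP : ((s₁ : ℤ) : ℂ) * s₂ * s₃ * s₄ = -1 := by exact_mod_cast hP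
  have K1 : (2 : ℂ) * w₁ = (s₁ : ℂ) * (T.card : ℂ) := by exact_mod_cast k1
  have K2 : (2 : ℂ) * w₂ = (s₂ : ℂ) * (T.card : ℂ) := by exact_mod_cast k2
  have K3 : (2 : ℂ) * w₃ = (s₃ : ℂ) * (T.card : ℂ) := by exact_mod_cast k3
  have K4 : (2 : ℂ) * w₄ = (s₄ : ℂ) * (T.card : ℂ) := by exact_mod_cast k4
  obtain ⟨u, hu₁, hu₂, hu₃⟩ := exists_apply_eq_rf hexp hχ₁ hχ₂ hχ₃ h12 h13 h23 hs₁' hs₂' hs₃'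
  refine ⟨u, fun g => ?_⟩
  -- inversion at `ug`
  have key := E (u * g)
  rw [AddChar.add_apply, AddChar.add_apply, char_mul_rf χ₁, char_mul_rf χ₂, char_mul_rf χ₃, hu₁, hu₂, hu₃,
    hG2] at key
  have key2 : 2 * (if u * g ∈ T then 2 * (T.card : ℂ) else 0) =
      2 * (T.card : ℂ) + (T.card : ℂ) * χ₁ (Additive.ofMul g) + (T.card : ℂ) * χ₂ (Additive.ofMul g) +
        (T.card : ℂ) * χ₃ (Additive.ofMul g) -
        (T.card : ℂ) * (χ₁ (Additive.ofMul g) * χ₂ (Additive.ofMul g) * χ₃ (Additive.ofMul g)) := by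
    linear_combination 2 * key + ((s₁ : ℂ) * χ₁ (Additive.ofMul g)) * K1 +
      ((s₂ : ℂ) * χ₂ (Additive.ofMul g)) * K2 + ((s₃ : ℂ) * χ₃ (Additive.ofMul g)) * K3 +
      ((s₁ : ℂ) * s₂ * s₃ * (χ₁ (Additive.ofMul g) * χ₂ (Additive.ofMul g) * χ₃ (Additive.ofMul g))) * K4 +
      ((T.card : ℂ) * (χ₁ (Additive.ofMul g) * χ₂ (Additive.ofMul g) * χ₃ (Additive.ofMul g))) * HP +
      ((T.card : ℂ) * χ₁ (Additive.ofMul g)) * HS1 + ((T.card : ℂ) * χ₂ (Additive.ofMul g)) * HS2 +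
      ((T.card : ℂ) * χ₃ (Additive.ofMul g)) * HS3
  exact iff_majority_of_key_rf hm0 (char_eq_one_or_rf hexp χ₁ g) (char_eq_one_or_rf hexp χ₂ g)
    (char_eq_one_or_rf hexp χ₃ g) key2

/-- **A CM TYPE OF RANK `5` IS A TRANSLATE OF A MAJORITY TYPE** (every finite commutative group of exponent `2`):
`rank(T) = 5 ⟹ ∃` distinct odd `χ₁, χ₂, χ₃` and `u` with `ug ∈ T ⟺ Maj(χ₁, χ₂, χ₃)(g)`.  On the field side: a
rank-`5` type of a multiquadratic CM field is induced from a NONDEGENERATE type of an octic CM subfield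
(`K^N`, `N = ker χ₁ ∩ ker χ₂ ∩ ker χ₃`). [cite: Kubota1965, §2] [cite: Kubota1965, §4 Lemma 2]
[cite: Carlet2020, §6.2 Prop. 94, Def. 62] -/
theorem exists_majority_translate_of_typeRank_eq_five (hexp : ∀ g : G, g ^ 2 = 1) (h : IsCMTypeWith ρ (T : Set G))
    (hr : typeRank G (T : Set G) = 5) :
    ∃ χ₁ χ₂ χ₃ : AddChar (Additive G) ℂ, χ₁ (Additive.ofMul ρ) = -1 ∧ χ₂ (Additive.ofMul ρ) = -1 ∧
      χ₃ (Additive.ofMul ρ) = -1 ∧ χ₁ ≠ χ₂ ∧ χ₁ ≠ χ₃ ∧ χ₂ ≠ χ₃ ∧ ∃ u : G, ∀ g : G, u * g ∈ T ↔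
        (χ₁ (Additive.ofMul g) = 1 ∧ χ₂ (Additive.ofMul g) = 1) ∨ (χ₁ (Additive.ofMul g) = 1 ∧ χ₃ (Additive.ofMul g) = 1) ∨
        (χ₂ (Additive.ofMul g) = 1 ∧ χ₃ (Additive.ofMul g) = 1) := by
  obtain ⟨χ₁, χ₂, χ₃, hχ₁, hχ₂, hχ₃, h12, h13, h23, hsurv⟩ := exists_survivors_eq_of_typeRank_eq_five hexp h hr
  rw [add_comm χ₃ (χ₁ + χ₂)] at hsurv
  exact ⟨χ₁, χ₂, χ₃, hχ₁, hχ₂, hχ₃, h12, h13, h23,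
    exists_forall_mul_mem_iff_majority_of_survivors_eq hexp h hχ₁ hχ₂ hχ₃ h12 h13 h23 hsurv⟩

omit [DecidableEq G] in
/-- **A TRANSLATE OF A MAJORITY TYPE HAS RANK `5`**: if `ug ∈ T ⟺ Maj(χ₁, χ₂, χ₃)(g)` for three distinct odd
characters then `T = Maj·u` is a CM type of rank `rank(Maj) = 5` (translates keep the rank, §1; tree
`typeRank_eq_five_of_majority`). [cite: Kubota1965, §2] [cite: Kubota1965, §4 Lemma 2] -/
theorem typeRank_eq_five_of_majority_translate (hexp : ∀ g : G, g ^ 2 = 1) (hχ₁ : χ₁ (Additive.ofMul ρ) = -1)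
    (hχ₂ : χ₂ (Additive.ofMul ρ) = -1) (hχ₃ : χ₃ (Additive.ofMul ρ) = -1) (h12 : χ₁ ≠ χ₂) (h13 : χ₁ ≠ χ₃)
    (h23 : χ₂ ≠ χ₃) {u : G}
    (hT : ∀ g : G, u * g ∈ T ↔ (χ₁ (Additive.ofMul g) = 1 ∧ χ₂ (Additive.ofMul g) = 1) ∨
      (χ₁ (Additive.ofMul g) = 1 ∧ χ₃ (Additive.ofMul g) = 1) ∨ (χ₂ (Additive.ofMul g) = 1 ∧ χ₃ (Additive.ofMul g) = 1)) :
    typeRank G (T : Set G) = 5 := by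
  classical
  have hρ2 : ρ * ρ = 1 := mul_self_eq_one_rf hexp ρ
  obtain ⟨M, hM⟩ : ∃ M : Finset G, ∀ g : G, g ∈ M ↔ (χ₁ (Additive.ofMul g) = 1 ∧ χ₂ (Additive.ofMul g) = 1) ∨
      (χ₁ (Additive.ofMul g) = 1 ∧ χ₃ (Additive.ofMul g) = 1) ∨ (χ₂ (Additive.ofMul g) = 1 ∧ χ₃ (Additive.ofMul g) = 1) :=
    ⟨Finset.univ.filter fun g : G => (χ₁ (Additive.ofMul g) = 1 ∧ χ₂ (Additive.ofMul g) = 1) ∨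
      (χ₁ (Additive.ofMul g) = 1 ∧ χ₃ (Additive.ofMul g) = 1) ∨ (χ₂ (Additive.ofMul g) = 1 ∧ χ₃ (Additive.ofMul g) = 1),
      fun g => by simp only [Finset.mem_filter, Finset.mem_univ, true_and]⟩
  rw [eq_image_mul_of_forall_iff_rf hM hT,
    AbelianTranslate.typeRank_image_mul_eq (isCMTypeWith_of_majority hexp hρ2 hχ₁ hχ₂ hχ₃ hM) u]
  exact typeRank_eq_five_of_majority hexp hρ2 hχ₁ hχ₂ hχ₃ h12 h13 h23 hM

/-- **RANK `5` ⟺ TRANSLATE OF A MAJORITY TYPE** — the classification of the CM types of Kubota rank `5` on the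
finite commutative groups of exponent `2` (every order `≥ 8`; ranks `≤ 4` other than `2` do not occur, tree
`typeRank_ne_three/four`).  On the field side: the rank-`5` CM types of a multiquadratic CM field are exactly the
types induced from the nondegenerate types of its octic CM subfields. [cite: Kubota1965, §2] [cite: Kubota1965, §4 Lemma 2]
[cite: Carlet2020, §6.2 Prop. 94, Def. 62] [cite: Gordon1999HodgeAVSurvey, §9.4.1 (Proposition [B.60])] -/
theorem typeRank_eq_five_iff_exists_majority_translate (hexp : ∀ g : G, g ^ 2 = 1)
    (h : IsCMTypeWith ρ (T : Set G)) :
    typeRank G (T : Set G) = 5 ↔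
      ∃ χ₁ χ₂ χ₃ : AddChar (Additive G) ℂ, χ₁ (Additive.ofMul ρ) = -1 ∧ χ₂ (Additive.ofMul ρ) = -1 ∧
        χ₃ (Additive.ofMul ρ) = -1 ∧ χ₁ ≠ χ₂ ∧ χ₁ ≠ χ₃ ∧ χ₂ ≠ χ₃ ∧ ∃ u : G, ∀ g : G, u * g ∈ T ↔
          (χ₁ (Additive.ofMul g) = 1 ∧ χ₂ (Additive.ofMul g) = 1) ∨ (χ₁ (Additive.ofMul g) = 1 ∧ χ₃ (Additive.ofMul g) = 1) ∨
          (χ₂ (Additive.ofMul g) = 1 ∧ χ₃ (Additive.ofMul g) = 1) :=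
  ⟨exists_majority_translate_of_typeRank_eq_five hexp h,
    fun ⟨_, _, _, hχ₁, hχ₂, hχ₃, h12, h13, h23, _, hT⟩ =>
      typeRank_eq_five_of_majority_translate hexp hχ₁ hχ₂ hχ₃ h12 h13 h23 hT⟩

end Structure

/-! ## §3 Consequences for a rank-`5` type: stabiliser of order exactly `|G|/8`, survivors `Ŝ = ±|G|/4` -/

section Consequences

omit [DecidableEq G] in
/-- **The stabiliser of a translate of `Maj(χ₁, χ₂, χ₃)` is the joint kernel `ker χ₁ ∩ ker χ₂ ∩ ker χ₃`** (a
translate has the stabiliser of `Maj`, tree `forall_mul_mem_iff_iff_of_majority`). [cite: Kubota1965, §2]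
[cite: Kubota1965, §4 Lemma 2] -/
theorem forall_mul_mem_iff_iff_of_majority_translate (hexp : ∀ g : G, g ^ 2 = 1)
    (hχ₁ : χ₁ (Additive.ofMul ρ) = -1) (hχ₂ : χ₂ (Additive.ofMul ρ) = -1) (hχ₃ : χ₃ (Additive.ofMul ρ) = -1)
    (h12 : χ₁ ≠ χ₂) (h13 : χ₁ ≠ χ₃) (h23 : χ₂ ≠ χ₃) {u : G}
    (hT : ∀ g : G, u * g ∈ T ↔ (χ₁ (Additive.ofMul g) = 1 ∧ χ₂ (Additive.ofMul g) = 1) ∨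
      (χ₁ (Additive.ofMul g) = 1 ∧ χ₃ (Additive.ofMul g) = 1) ∨ (χ₂ (Additive.ofMul g) = 1 ∧ χ₃ (Additive.ofMul g) = 1))
    (x : G) :
    (∀ y : G, y * x ∈ T ↔ y ∈ T) ↔
      χ₁ (Additive.ofMul x) = 1 ∧ χ₂ (Additive.ofMul x) = 1 ∧ χ₃ (Additive.ofMul x) = 1 := by
  classical
  have hρ2 : ρ * ρ = 1 := mul_self_eq_one_rf hexp ρ
  obtain ⟨M, hM⟩ : ∃ M : Finset G, ∀ g : G, g ∈ M ↔ (χ₁ (Additive.ofMul g) = 1 ∧ χ₂ (Additive.ofMul g) = 1) ∨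
      (χ₁ (Additive.ofMul g) = 1 ∧ χ₃ (Additive.ofMul g) = 1) ∨ (χ₂ (Additive.ofMul g) = 1 ∧ χ₃ (Additive.ofMul g) = 1) :=
    ⟨Finset.univ.filter fun g : G => (χ₁ (Additive.ofMul g) = 1 ∧ χ₂ (Additive.ofMul g) = 1) ∨
      (χ₁ (Additive.ofMul g) = 1 ∧ χ₃ (Additive.ofMul g) = 1) ∨ (χ₂ (Additive.ofMul g) = 1 ∧ χ₃ (Additive.ofMul g) = 1),
      fun g => by simp only [Finset.mem_filter, Finset.mem_univ, true_and]⟩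
  rw [forall_mul_mem_iff_translate_rf hM hT x]
  exact forall_mul_mem_iff_iff_of_majority hexp hρ2 hχ₁ hχ₂ hχ₃ h12 h13 h23 hM x

/-- **A RANK-`5` TYPE HAS A STABILISER OF ORDER EXACTLY `|G|/8`**: `8·#{g : Tg = T} = |G|` (the tree's
`card_le_eight_mul_card_filter_forall_mul_mem_iff_of_typeRank_eq_five` gave `|G| ≤ 8·|Stab(T)|`).  On the field
side: a rank-`5` CM type of a multiquadratic CM field `K` is induced from exactly one subfield, an octic one (its
reflex field has degree `8`). [cite: Kubota1965, §2] [cite: Kubota1965, §4 Lemma 2] [cite: Shimura1998, §8.4 Example (1)] -/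
theorem eight_mul_card_stabilizer_of_typeRank_eq_five (hexp : ∀ g : G, g ^ 2 = 1) (h : IsCMTypeWith ρ (T : Set G))
    (hr : typeRank G (T : Set G) = 5) :
    8 * (Finset.univ.filter fun g : G => ∀ t : G, t * g ∈ T ↔ t ∈ T).card = Fintype.card G := by
  obtain ⟨χ₁, χ₂, χ₃, hχ₁, hχ₂, hχ₃, h12, h13, h23, u, hT⟩ := exists_majority_translate_of_typeRank_eq_five hexp h hr
  rw [Finset.filter_congr fun g _ => forall_mul_mem_iff_iff_of_majority_translate hexp hχ₁ hχ₂ hχ₃ h12 h13 h23 hT g]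
  exact eight_mul_card_filter_eq_eq_eq_of_odd hexp hχ₁ hχ₂ hχ₃ h12 h13 h23 (Or.inl rfl) (Or.inl rfl) (Or.inl rfl)

/-- **EVERY SURVIVOR OF A RANK-`5` TYPE HAS `Ŝ(χ) = ±|G|/4`**: `4·Ŝ(χ) = |G|` or `= −|G|` for each odd `χ` with
`Ŝ(χ) ≠ 0` (for `T = Maj·u`: `Ŝ_T(χ) = χ(u)Ŝ_{Maj}(χ)` and `Ŝ_{Maj} = |G|/4, |G|/4, |G|/4, −|G|/4` on its four
survivors) — the "one non-zero absolute Walsh value" of a partially-bent function. [cite: Kubota1965, §4 Lemma 2]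
[cite: Carlet2020, §6.2 Prop. 94, Def. 62] [cite: Dodson1984, §3.1.1 Theorem] -/
theorem four_mul_sum_char_eq_or_of_typeRank_eq_five (hexp : ∀ g : G, g ^ 2 = 1) (h : IsCMTypeWith ρ (T : Set G))
    (hr : typeRank G (T : Set G) = 5) {χ : AddChar (Additive G) ℂ} (hχ : χ (Additive.ofMul ρ) = -1)
    (hS : ∑ s ∈ T, χ (Additive.ofMul s) ≠ 0) :
    4 * ∑ s ∈ T, χ (Additive.ofMul s) = Fintype.card G ∨ 4 * ∑ s ∈ T, χ (Additive.ofMul s) = -(Fintype.card G : ℂ) := by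
  obtain ⟨χ₁, χ₂, χ₃, hχ₁, hχ₂, hχ₃, h12, h13, h23, u, hT⟩ := exists_majority_translate_of_typeRank_eq_five hexp h hr
  have hρ2 : ρ * ρ = 1 := mul_self_eq_one_rf hexp ρ
  obtain ⟨M, hM⟩ : ∃ M : Finset G, ∀ g : G, g ∈ M ↔ (χ₁ (Additive.ofMul g) = 1 ∧ χ₂ (Additive.ofMul g) = 1) ∨
      (χ₁ (Additive.ofMul g) = 1 ∧ χ₃ (Additive.ofMul g) = 1) ∨ (χ₂ (Additive.ofMul g) = 1 ∧ χ₃ (Additive.ofMul g) = 1) :=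
    ⟨Finset.univ.filter fun g : G => (χ₁ (Additive.ofMul g) = 1 ∧ χ₂ (Additive.ofMul g) = 1) ∨
      (χ₁ (Additive.ofMul g) = 1 ∧ χ₃ (Additive.ofMul g) = 1) ∨ (χ₂ (Additive.ofMul g) = 1 ∧ χ₃ (Additive.ofMul g) = 1),
      fun g => by simp only [Finset.mem_filter, Finset.mem_univ, true_and]⟩
  have hTM : T = M.image fun s => s * u := eq_image_mul_of_forall_iff_rf hM hT
  have hSu : ∑ s ∈ T, χ (Additive.ofMul s) = χ (Additive.ofMul u) * ∑ s ∈ M, χ (Additive.ofMul s) := by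
    rw [hTM]
    exact AbelianStabilizer.sum_char_image_mul_eq χ M u
  have hSM : ∑ s ∈ M, χ (Additive.ofMul s) ≠ 0 := fun h0 => hS (by rw [hSu, h0, mul_zero])
  have hmem : χ ∈ ((Finset.univ.filter fun χ : AddChar (Additive G) ℂ => χ (Additive.ofMul ρ) = -1).filter
      fun χ => ∑ s ∈ M, χ (Additive.ofMul s) ≠ 0) := by
    simp only [Finset.mem_filter, Finset.mem_univ, true_and]
    exact ⟨hχ, hSM⟩
  rw [survivors_eq_of_majority hexp hρ2 hχ₁ hχ₂ hχ₃ h12 h13 h23 hM] at hmem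
  have hG : 4 * ∑ s ∈ M, χ (Additive.ofMul s) = Fintype.card G ∨
      4 * ∑ s ∈ M, χ (Additive.ofMul s) = -(Fintype.card G : ℂ) := by
    simp only [Finset.mem_insert, Finset.mem_singleton] at hmem
    rcases hmem with rfl | rfl | rfl | rfl
    · exact Or.inl (four_mul_sum_char_of_majority₁ hexp hρ2 hχ₁ hχ₂ hχ₃ h12 h13 h23 hM)
    · exact Or.inl (four_mul_sum_char_of_majority₂ hexp hρ2 hχ₁ hχ₂ hχ₃ h12 h13 h23 hM)
    · exact Or.inl (four_mul_sum_char_of_majority₃ hexp hρ2 hχ₁ hχ₂ hχ₃ h12 h13 h23 hM)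
    · exact Or.inr (four_mul_sum_char_add_of_majority hexp hρ2 hχ₁ hχ₂ hχ₃ h12 h13 h23 hM)
  rw [hSu]
  rcases char_eq_one_or_rf hexp χ u with e | e <;> rcases hG with hG | hG
  · left; rw [e, one_mul]; exact hG
  · right; rw [e, one_mul]; exact hG
  · right; rw [e, ← mul_assoc, mul_neg_one, neg_mul, hG]
  · left; rw [e, ← mul_assoc, mul_neg_one, neg_mul, hG, neg_neg]

/-- **The sign counts of a rank-`5` type**: for every surviving odd `χ`, `a_χ = #{t ∈ T : χ(t) = −1}` is `|G|/8` or
`3|G|/8` (`8a_χ = |G|` or `8a_χ = 3|G|`; `Ŝ(χ) = |T| − 2a_χ = ±|G|/4`). [cite: Dodson1984, §3.1.1 Theorem]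
[cite: Kubota1965, §4 Lemma 2] -/
theorem eight_mul_card_filter_eq_neg_one_or_of_typeRank_eq_five (hexp : ∀ g : G, g ^ 2 = 1)
    (h : IsCMTypeWith ρ (T : Set G)) (hr : typeRank G (T : Set G) = 5) {χ : AddChar (Additive G) ℂ}
    (hχ : χ (Additive.ofMul ρ) = -1) (hS : ∑ s ∈ T, χ (Additive.ofMul s) ≠ 0) :
    8 * (T.filter fun s => χ (Additive.ofMul s) = -1).card = Fintype.card G ∨
      8 * (T.filter fun s => χ (Additive.ofMul s) = -1).card = 3 * Fintype.card G := by
  have hTc : 2 * T.card = Fintype.card G := two_mul_card_rf h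
  have h1 : (Fintype.card G : ℂ) = 2 * (T.card : ℂ) := by exact_mod_cast hTc.symm
  have h4 := four_mul_sum_char_eq_or_of_typeRank_eq_five hexp h hr hχ hS
  rw [sum_char_eq_card_sub_two_mul hexp χ T] at h4
  rcases h4 with h4 | h4
  · left
    have : (8 * (T.filter fun s => χ (Additive.ofMul s) = -1).card : ℂ) = Fintype.card G := by
      linear_combination -h4 - 2 * h1
    exact_mod_cast this
  · right
    have : (8 * (T.filter fun s => χ (Additive.ofMul s) = -1).card : ℂ) = 3 * Fintype.card G := by
      linear_combination -h4 - 2 * h1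
    exact_mod_cast this

end Consequences

end ExponentTwo

end CyclicCMType

end Literature.NumberTheory.ComplexMultiplication
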